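import Summits.MatrixMultiplication.OmegaCensus.SmallFormats.GF2OrbitSweep
import HarnessLib

/-!
# MM22 venture, Route D3 — transports for `𝔽₂` orbit certificates: transposes and hypotheses

HONEST FRAMING (cell `pub-mm22`, seat p3). Replay infrastructure only; no bound on `⟨3,3,3⟩` is
claimed here. The tree's kernel checker for Wang-2026-style `𝔽₂` rank-lower-bound certificates
(`Summits/MatrixMultiplication/OmegaCensus/SmallFormats/GF2OrbitSweep.lean`, cell `pub-omega`:
orbit list `os`, steps flatten / lookup / forced product / DFS, `sweep`, `le_tensorRank_of_sweep`)
justifies an orbit bound ONLY by that orbit's own steps. Wang's `⟨3,3,3⟩` certificate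
(arXiv:2603.07280, `cert_matrix_q02_n333`) additionally uses, for the cubic format, the TRANSPOSE
symmetry `X ↦ Xᵀ` of the first factor in its orbit witnesses (`problems/matrix/symmetry.h`:
`G = (GL₃ × GL₃) ⋊ C₂`), and a partial replay needs orbit bounds taken as HYPOTHESES. This file adds
both, PROVED (0 sorry), without touching the landed checker:

* `trb n κ` — the bit pattern of the transposed constraint form; `form_trb : form n n (trb n κ) X = form n n κ Xᵀ`;
* `transposeComp` — from a bilinear computation of `(X, Y) ↦ X Y` on `S_{Kᵀ} × 𝔽₂^{n×n}` one of the
  SAME length on `S_K × 𝔽₂^{n×n}`: `f'_i(X) = f_i(Xᵀ)`, `g'_i(Y) = Σ_{p,q} (w_i)_{pq} Y_{pq}`,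
  `w'_i = (g_i(E_{ac}))_{ac}` — the transpose automorphism `tr(XYZ) = tr(Xᵀ Zᵀ Yᵀ)` of the matrix
  multiplication tensor written out for bilinear computations (it exchanges the roles of the second
  input and the output); `cert_transpose : Cert n n n K b → Cert n n n (K.map (trb n)) b`;
* `okJ` / `sweepJ` / `le_tensorRank_of_sweepJ` — the sweep of `GF2OrbitSweep` with two more ways to
  justify orbit `i`: a HYPOTHESIS bound `hypB hyps i` (an assumed `Cert`, hypotheses `∀ e ∈ hyps, Cert n n n (kOf os e.1) e.2`), or "transpose of an earlier orbit
  `j`" (`kOf os i = (kOf os j).map (trb n)`, `bnd os i ≤ bnd os j`).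

References: Wang 2026, arXiv:2603.07280, §3.1 (symmetries), §6–§7 (orbit certificates); the tree files
named above (pub-omega) for the checker whose theorems (`foldl_sound`, `le_tensorRank_matMulTensor_of_forall_constrained`)
are reused verbatim.
-/

namespace Summit.Ventures.MM22.GF2Cert

open Module Matrix Literature.Computability.AlgebraicComplexity
open Summit.MatrixMultiplication.OmegaCensus.GF2RankLB

/-! ## Transposed constraint forms -/

/-- Bit pattern of the transposed form: bit `(i,j)` of `trb n κ` is bit `(j,i)` of `κ` (`n × n` matrices,
position `pos n i j = j + n i`). -/
def trb (n κ : ℕ) : ℕ := maskOf (fun p => κ.testBit (pos n (p % n) (p / n))) (n * n)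

/-- Bits of `trb`. -/
theorem testBit_trb (n κ : ℕ) (i j : Fin n) : (trb n κ).testBit (pos n i j) = κ.testBit (pos n j i) := by
  have hn : 0 < n := Fin.pos i
  have hlt : pos n i j < n * n := by
    have := i.2; have := j.2
    calc (j : ℕ) + n * i < n + n * i := by omega
      _ = n * (i + 1) := by ring
      _ ≤ n * n := Nat.mul_le_mul_left _ (by omega)
  rw [trb, testBit_maskOf]
  simp only [hlt, decide_true, Bool.true_and]
  have h1 : ((j : ℕ) + n * i) % n = j := by
    rw [Nat.add_mul_mod_self_left, Nat.mod_eq_of_lt j.2]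
  have h2 : ((j : ℕ) + n * i) / n = i := by
    rw [Nat.add_mul_div_left _ _ hn, Nat.div_eq_of_lt j.2, zero_add]
  simp only [pos, h1, h2]

/-- The transposed form evaluates on `X` as the form on `Xᵀ`. -/
theorem form_trb (n κ : ℕ) (X : Matrix (Fin n) (Fin n) (ZMod 2)) :
    form n n (trb n κ) X = form n n κ Xᵀ := by
  rw [form_apply, form_apply, Finset.sum_comm]
  refine Finset.sum_congr rfl fun i _ => Finset.sum_congr rfl fun j _ => ?_
  rw [testBit_trb, transpose_apply]

/-- `X ∈ S_K ↔ Xᵀ ∈ S_{Kᵀ}`. -/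
theorem transpose_mem_subOf_iff (n : ℕ) (K : List ℕ) (X : Matrix (Fin n) (Fin n) (ZMod 2)) :
    Xᵀ ∈ subOf n n (K.map (trb n)) ↔ X ∈ subOf n n K := by
  simp only [subOf, mem_constrSub, List.map_map, List.mem_map, forall_exists_index, and_imp,
    forall_apply_eq_imp_iff₂, Function.comp_apply, form_trb, transpose_transpose]

/-- The transpose as a linear map `S_K → S_{Kᵀ}`. -/
def trSub (n : ℕ) (K : List ℕ) : subOf n n K →ₗ[ZMod 2] subOf n n (K.map (trb n)) where
  toFun X := ⟨(X : Matrix (Fin n) (Fin n) (ZMod 2))ᵀ, (transpose_mem_subOf_iff n K X).2 X.2⟩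
  map_add' X Y := by ext; simp
  map_smul' a X := by ext; simp

/-- Coercion of `trSub`. -/
@[simp] theorem coe_trSub (n : ℕ) (K : List ℕ) (X : subOf n n K) :
    (trSub n K X : Matrix (Fin n) (Fin n) (ZMod 2)) = (X : Matrix (Fin n) (Fin n) (ZMod 2))ᵀ := rfl

/-- The Frobenius pairing with a fixed matrix `W`, as a linear form: `Y ↦ Σ_{p,q} W_{pq} Y_{pq}`. -/
def frob (n : ℕ) (W : Matrix (Fin n) (Fin n) (ZMod 2)) : Module.Dual (ZMod 2) (Matrix (Fin n) (Fin n) (ZMod 2)) where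
  toFun Y := ∑ p, ∑ q, W p q * Y p q
  map_add' Y Y' := by
    simp only [Matrix.add_apply, mul_add, Finset.sum_add_distrib]
  map_smul' a Y := by
    simp only [Matrix.smul_apply, smul_eq_mul, RingHom.id_apply, Finset.mul_sum]
    refine Finset.sum_congr rfl fun p _ => Finset.sum_congr rfl fun q _ => ?_
    ring

/-- Evaluation of `frob`. -/
@[simp] theorem frob_apply (n : ℕ) (W Y : Matrix (Fin n) (Fin n) (ZMod 2)) :
    frob n W Y = ∑ p, ∑ q, W p q * Y p q := rfl

/-- **Transpose transport of a bilinear computation** (the automorphism `tr(XYZ) = tr(Xᵀ Zᵀ Yᵀ)` of the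
matrix multiplication tensor, for computations restricted to a constraint subspace of the first factor):
from a computation of `(X, Y) ↦ X Y` on `S_{Kᵀ}` a computation of the same length on `S_K`. -/
def transposeComp {n : ℕ} {K : List ℕ} {ι : Type*} [Fintype ι]
    (β : BilinComp (psiK n n n (K.map (trb n))) ι) : BilinComp (psiK n n n K) ι where
  f i := (β.f i).comp (trSub n K)
  g i := frob n (β.w i)
  w i := Matrix.of fun a c => β.g i (Matrix.single a c 1)
  map_eq_sum X Y := by
    -- the identity (†): entries of `Xᵀ E_{ac} = Σ_i f_i(Xᵀ) g_i(E_{ac}) w_i`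
    have key : ∀ (a c p q : Fin n),
        (∑ i, β.f i (trSub n K X) * β.g i (Matrix.single a c 1) * β.w i p q) =
          if q = c then (X : Matrix (Fin n) (Fin n) (ZMod 2)) a p else 0 := by
      intro a c p q
      have h := β.map_eq_sum (trSub n K X) (Matrix.single a c 1)
      have h' := congrArg (fun M : Matrix (Fin n) (Fin n) (ZMod 2) => M p q) h
      simp only [LinearMap.comp_apply, Submodule.subtype_apply, mulBilin_apply, coe_trSub,
        Matrix.sum_apply, Matrix.smul_apply, smul_eq_mul] at h'
      rw [← h']
      by_cases hq : q = c
      · rw [hq, if_pos rfl, Matrix.mul_single_apply_same, transpose_apply, mul_one]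
      · rw [if_neg hq]
        simp [Matrix.mul_apply, Matrix.single, Ne.symm hq]
    have eR : (∑ i, (β.f i (trSub n K X) * frob n (β.w i) Y) •
          (Matrix.of fun a c => β.g i (Matrix.single a c 1))) =
        Matrix.of fun a c => ∑ p, ∑ q,
          Y p q * ∑ i, β.f i (trSub n K X) * β.g i (Matrix.single a c 1) * β.w i p q := by
      ext a c
      rw [Matrix.sum_apply, Matrix.of_apply]
      simp only [Matrix.smul_apply, smul_eq_mul, Matrix.of_apply, frob_apply, Finset.mul_sum,
        Finset.sum_mul]
      rw [Finset.sum_comm]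
      refine Finset.sum_congr rfl fun p _ => ?_
      rw [Finset.sum_comm]
      refine Finset.sum_congr rfl fun q _ => Finset.sum_congr rfl fun i _ => ?_
      ring
    simp only [LinearMap.comp_apply, Submodule.subtype_apply, mulBilin_apply]
    rw [eR]
    ext a c
    rw [Matrix.mul_apply, Matrix.of_apply]
    refine Finset.sum_congr rfl fun p _ => ?_
    simp_rw [key]
    simp only [mul_ite, mul_zero, Finset.sum_ite_eq', Finset.mem_univ, if_true]
    rw [mul_comm]

/-- **Transpose transport of certified bounds**: a lower bound for all computations on `S_K` is a lower
bound for all computations on `S_{Kᵀ}`. -/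
theorem cert_transpose {n : ℕ} {K : List ℕ} {b : ℕ} (h : Cert n n n K b) : Cert n n n (K.map (trb n)) b :=
  fun r β => h r (transposeComp β)

/-- Weakening a certified bound. -/
theorem cert_mono {l m n : ℕ} {K : List ℕ} {b b' : ℕ} (hb : b' ≤ b) (h : Cert l m n K b) : Cert l m n K b' :=
  fun r β => hb.trans (h r β)

/-! ## The sweep with hypotheses and transposes -/

variable (n : ℕ)

/-- Hypothesis bound of orbit `i` from a list of `(orbit, bound)` pairs (`0` if absent). -/
def hypB (hyps : List (ℕ × ℕ)) (i : ℕ) : ℕ :=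
  match hyps.find? (fun e => e.1 == i) with
  | some e => e.2
  | none => 0

/-- Transpose source of orbit `i` from a list of `(orbit, source)` pairs. -/
def trOf (trs : List (ℕ × ℕ)) (i : ℕ) : Option ℕ :=
  (trs.find? (fun e => e.1 == i)).map (·.2)

/-- The extended orbit check: own steps, or a hypothesis, or the transpose of an earlier orbit. -/
def okJ (os : List Orbit) (hyps trs : List (ℕ × ℕ)) (i : ℕ) : Bool :=
  orbitCheck n n n os i || decide (bnd os i ≤ hypB hyps i) ||
    (match trOf trs i with
     | some j => decide (j < i) && decide (kOf os i = (kOf os j).map (trb n)) && decide (bnd os i ≤ bnd os j)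
     | none => false)

variable {n}

/-- The hypothesis bound is certified under `Hyps`. -/
theorem cert_hypB {os : List Orbit} {hyps : List (ℕ × ℕ)}
    (h : ∀ e ∈ hyps, Cert n n n (kOf os e.1) e.2) (i : ℕ) :
    Cert n n n (kOf os i) (hypB hyps i) := by
  unfold hypB
  split
  · next e he =>
    have hmem := List.mem_of_find?_eq_some he
    have hi : e.1 = i := by simpa using List.find?_some he
    rw [← hi]
    exact h e hmem
  · exact fun _ _ => Nat.zero_le _

/-- **The extended sweep**: if every orbit passes `okJ`, all residual obligations hold and the hypotheses
hold, then every claimed bound is certified. -/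
theorem sweepJ (os : List Orbit) (hyps trs : List (ℕ × ℕ))
    (hall : ∀ i < os.length, okJ n os hyps trs i = true)
    (hob : ∀ i < os.length, Obligs n n os i) (hh : ∀ e ∈ hyps, Cert n n n (kOf os e.1) e.2) :
    ∀ i < os.length, Cert n n n (kOf os i) (bnd os i) := by
  intro i
  induction i using Nat.strong_induction_on with
  | _ i IHi =>
    intro hi
    have IH : ∀ j < i, Cert n n n (kOf os j) (bnd os j) := fun j hj => IHi j hj (lt_trans hj hi)
    have hc := hall i hi
    simp only [okJ, Bool.or_eq_true, decide_eq_true_eq] at hc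
    rcases hc with (hc | hc) | hc
    · rw [orbitCheck, decide_eq_true_eq] at hc
      have hf := foldl_sound os i IH (kOf os i) (os.getD i default).steps 0 (fun _ _ => Nat.zero_le _) (hob i hi)
      exact fun r β => hc.trans (hf r β)
    · exact cert_mono hc (cert_hypB hh i)
    · revert hc
      cases htr : trOf trs i with
      | none => simp
      | some j =>
        simp only [Bool.and_eq_true, decide_eq_true_eq]
        rintro ⟨⟨hj, hK⟩, hb⟩
        rw [hK]
        exact cert_mono hb (cert_transpose (IH j hj))

/-- **Reading off the rank bound** at the unconstrained orbit, under the hypotheses. -/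
theorem le_tensorRank_of_sweepJ (os : List Orbit) (hyps trs : List (ℕ × ℕ))
    (hall : ∀ i < os.length, okJ n os hyps trs i = true)
    (hob : ∀ i < os.length, Obligs n n os i) (hh : ∀ e ∈ hyps, Cert n n n (kOf os e.1) e.2)
    (i : ℕ) (hi : i < os.length) (hK : kOf os i = []) :
    bnd os i ≤ tensorRank (matMulTensor (ZMod 2) n n n) := by
  have h := sweepJ os hyps trs hall hob hh i hi
  rw [hK] at h
  exact le_tensorRank_matMulTensor_of_forall_constrained (subOf n n []) h

/-- `okJ` from the plain orbit check (for orbits proved by their own steps, e.g. via `orbitCheck_of_chain`). -/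
theorem okJ_of_orbitCheck {os : List Orbit} {hyps trs : List (ℕ × ℕ)} {i : ℕ}
    (h : orbitCheck n n n os i = true) : okJ n os hyps trs i = true := by
  simp [okJ, h]

end Summit.Ventures.MM22.GF2Cert
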